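import Literature.NumberTheory.LFunctions.PagePNTWithExceptionalZero
import Literature.NumberTheory.LFunctions.PagePNTExceptionalData
import Literature.NumberTheory.Sieve.DivisorBound
import Literature.NumberTheory.Sieve.PrimePowersInProgressions
import HarnessLib

/-!
# Proof of the prime number theorem for progressions with the exceptional-zero term
# (Page; Montgomery–Vaughan Corollary 11.17, (11.29))

Topic `Literature/NumberTheory/LFunctions`. Everything in this file is PROVED (theorems only); it
discharges the named fact `Literature.NumberTheory.LFunctions.PagePNTWithExceptionalZero`
(`PagePNTWithExceptionalZero.lean`):

> there are absolute `c, c₁, K > 0` such that for every modulus `q ≥ 1`, every real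
> non-principal `χ` mod `q`, every real zero `β ∈ (1 − c/log 4q, 1)` of `L(s, χ)`, every reduced
> class `a` mod `q` and every `x ≥ 2`,
> `|ψ(x; q, a) − x/φ(q) + χ(a)x^β/(φ(q)β)| ≤ K x exp(−c₁√log x)`.

The argument is Montgomery–Vaughan's (§11.3, proof of Theorem 11.16, Case 2, and of
Corollary 11.17): for `log q ≤ C₀√log x` (and `x ≥ 64`) it is Landau's method for
`Λ_{q,a} = φ(q)Λ𝟙_{≡ a}` with the two main terms `x` and `−χ(a)x^β/β` —
`Literature.NumberTheory.LFunctions.ExcPsiData.exists_psi_bound` (`ExceptionalZeroPsi.lean`) fed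
with the hypotheses `Literature.NumberTheory.LFunctions.PagePNT.exists_excPsiData`
(`PagePNTExceptionalData.lean`), whose constant `Kq⁵` is absorbed by `q⁵ ≤ e^{(c/160)√log x}`;
"if `q` is larger, then the stated estimates are still valid, but are worse than trivial"
(MV, proof of Cor. 11.17): for `log q > C₀√log x` one has `ψ(x;q,a) ≤ (x/q + 1)log x`,
`x/φ(q) ≤ C x/√q` (`φ(q)τ(q) ≥ q` and the divisor bound `τ(q) ≪ q^{1/2}`,
`Literature.NumberTheory.Sieve.exists_card_divisors_le_mul_rpow'`), each `≪ x e^{−(C₀/2)√log x}`;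
and for `x < 64` everything is bounded.

## References

* H. L. Montgomery, R. C. Vaughan, *Multiplicative Number Theory I. Classical Theory*, CUP 2007,
  §11.3, Theorem 11.16 and Corollary 11.17 with the paragraph following its proof
  (`MontgomeryVaughan2007`).
* A. Page, *On the number of primes in an arithmetic progression*, Proc. London Math. Soc. (2) 39
  (1935), 116–141 (through MV's attribution).
-/

noncomputable section

open Finset Real

namespace Literature.NumberTheory.LFunctions

namespace PagePNT

open Literature.NumberTheory.Sieve

/-! ## Trivial bounds -/

/-- **The trivial bound** `ψ(x; q, a) ≤ (x/q + 1) log x` for `q ≥ 1`, `x ≥ 1`: each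
`Λ(n) ≤ log n ≤ log x` and `#{n ≤ x : n ≡ a (q)} ≤ x/q + 1` ("worse than trivial", MV proof of
Cor. 11.17). [cite: MontgomeryVaughan2007, Corollary 11.17 (proof)] -/
theorem chebyshevPsiMod_le_trivial {q : ℕ} (hq : 1 ≤ q) (a : ZMod q) {x : ℝ} (hx : 1 ≤ x) :
    ParityWave0.chebyshevPsiMod q a x ≤ (x / q + 1) * Real.log x := by
  have hx0 : 0 ≤ x := zero_le_one.trans hx
  have hlog0 : 0 ≤ Real.log x := Real.log_nonneg hx
  unfold ParityWave0.chebyshevPsiMod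
  calc ∑ n ∈ range (⌊x⌋₊ + 1), ArithmeticFunction.vonMangoldt.residueClass a n
      ≤ ∑ n ∈ range (⌊x⌋₊ + 1), (if (n : ZMod q) = a then Real.log x else 0) := by
        refine Finset.sum_le_sum fun n hn ↦ ?_
        simp only [ArithmeticFunction.vonMangoldt.residueClass, Set.indicator_apply,
          Set.mem_setOf_eq]
        split_ifs with h
        · refine ArithmeticFunction.vonMangoldt_le_log.trans ?_
          rcases Nat.eq_zero_or_pos n with rfl | hn0
          · simp [hlog0]
          · have hnx : (n : ℝ) ≤ x :=
              (Nat.cast_le.2 (Nat.lt_succ_iff.1 (mem_range.1 hn))).trans (Nat.floor_le hx0)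
            exact Real.log_le_log (by exact_mod_cast hn0) hnx
        · exact le_rfl
    _ = Real.log x * #((range (⌊x⌋₊ + 1)).filter fun n : ℕ ↦ (n : ZMod q) = a) := by
        rw [← Finset.sum_filter, Finset.sum_const, nsmul_eq_mul, mul_comm]
    _ ≤ Real.log x * (x / q + 1) := by
        refine mul_le_mul_of_nonneg_left ?_ hlog0
        have h1 := card_range_filter_natCast_eq_le q a ⌊x⌋₊
        have h2 : ((⌊x⌋₊ / q : ℕ) : ℝ) ≤ x / q :=
          (Nat.cast_div_le).trans (div_le_div_of_nonneg_right (Nat.floor_le hx0) (by positivity))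
        calc (#((range (⌊x⌋₊ + 1)).filter fun n : ℕ ↦ (n : ZMod q) = a) : ℝ)
            ≤ ((⌊x⌋₊ / q + 1 : ℕ) : ℝ) := by exact_mod_cast h1
          _ ≤ x / q + 1 := by push_cast; linarith
    _ = (x / q + 1) * Real.log x := mul_comm _ _

/-- **`φ(q) ≫ √q`**: there is `C ≥ 1` with `√q ≤ C φ(q)` for all `q ≥ 1` (`q = ∑_{d∣q} φ(d) ≤ τ(q)φ(q)`
and the divisor bound `τ(q) ≤ C q^{1/2}`). [folklore] -/
theorem exists_sqrt_le_mul_totient :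
    ∃ C : ℝ, 1 ≤ C ∧ ∀ q : ℕ, q ≠ 0 → Real.sqrt q ≤ C * Nat.totient q := by
  obtain ⟨C, hC1, hC⟩ := exists_card_divisors_le_mul_rpow' (ε := 1 / 2) (by norm_num)
  refine ⟨C, hC1, fun q hq ↦ ?_⟩
  have hqpos := Nat.pos_of_ne_zero hq
  have key : q ≤ Nat.totient q * #q.divisors := by
    calc q = ∑ d ∈ q.divisors, Nat.totient d := (Nat.sum_totient q).symm
      _ ≤ ∑ d ∈ q.divisors, Nat.totient q :=
          Finset.sum_le_sum fun d hd ↦ Nat.le_of_dvd (Nat.totient_pos.2 hqpos)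
            (Nat.totient_dvd_of_dvd (Nat.dvd_of_mem_divisors hd))
      _ = #q.divisors * Nat.totient q := by rw [Finset.sum_const, smul_eq_mul]
      _ = Nat.totient q * #q.divisors := mul_comm _ _
  have h1 : (q : ℝ) ≤ Nat.totient q * #q.divisors := by exact_mod_cast key
  have h2 := hC q
  have hq0 : (0 : ℝ) < q := by exact_mod_cast hqpos
  set s : ℝ := Real.sqrt q with hs
  have hs0 : 0 < s := Real.sqrt_pos.2 hq0
  have hss : s * s = q := Real.mul_self_sqrt hq0.le
  have hrpow : (q : ℝ) ^ (1 / 2 : ℝ) = s := by rw [hs, Real.sqrt_eq_rpow]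
  rw [hrpow] at h2
  have hφ0 : (0 : ℝ) ≤ Nat.totient q := Nat.cast_nonneg _
  have h3 : s * s ≤ (C * Nat.totient q) * s := by
    calc s * s = q := hss
      _ ≤ Nat.totient q * #q.divisors := h1
      _ ≤ Nat.totient q * (C * s) := mul_le_mul_of_nonneg_left h2 hφ0
      _ = (C * Nat.totient q) * s := by ring
  exact le_of_mul_le_mul_right h3 hs0

/-- The trivial estimate of the whole quantity: for `q ≥ 1`, `x ≥ 1`, `1/2 ≤ β ≤ 1`, `|α| ≤ 1`,
`|ψ(x;q,a) − x/φ(q) + αx^β/(φ(q)β)| ≤ (x/q + 1)log x + 3x/φ(q)`. [folklore] -/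
theorem abs_sub_main_le_trivial {q : ℕ} [NeZero q] (a : ZMod q) {x β α : ℝ} (hx : 1 ≤ x)
    (hβ : 1 / 2 ≤ β) (hβ1 : β ≤ 1) (hα : |α| ≤ 1) :
    |ParityWave0.chebyshevPsiMod q a x - x / Nat.totient q +
        α * x ^ β / (Nat.totient q * β)| ≤
      (x / q + 1) * Real.log x + 3 * x / Nat.totient q := by
  have hx0 : 0 < x := by linarith
  have hφpos : (0 : ℝ) < Nat.totient q := by exact_mod_cast Nat.totient_pos.2 (NeZero.pos q)
  have hψ0 : 0 ≤ ParityWave0.chebyshevPsiMod q a x :=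
    Finset.sum_nonneg fun n _ ↦ ArithmeticFunction.vonMangoldt.residueClass_nonneg a n
  have hψ := chebyshevPsiMod_le_trivial NeZero.one_le a hx
  have hxβ : x ^ β ≤ x := by
    have := Real.rpow_le_rpow_of_exponent_le hx hβ1
    rwa [Real.rpow_one] at this
  have hxβ0 : 0 ≤ x ^ β := (Real.rpow_pos_of_pos hx0 β).le
  have hβ0 : 0 < β := by linarith
  have h3 : |α * x ^ β / (Nat.totient q * β)| ≤ 2 * x / Nat.totient q := by
    rw [abs_div, abs_mul, abs_of_nonneg hxβ0, abs_of_pos (mul_pos hφpos hβ0),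
      div_le_div_iff₀ (mul_pos hφpos hβ0) hφpos]
    have h1 : |α| * x ^ β ≤ 1 * x := mul_le_mul hα hxβ hxβ0 zero_le_one
    have h2 : (1 : ℝ) ≤ 2 * β := by linarith
    calc |α| * x ^ β * Nat.totient q ≤ (1 * x) * Nat.totient q :=
          mul_le_mul_of_nonneg_right h1 hφpos.le
      _ = x * Nat.totient q * 1 := by ring
      _ ≤ x * Nat.totient q * (2 * β) := by gcongr
      _ = 2 * x * (Nat.totient q * β) := by ring
  have h2 : |x / Nat.totient q| = x / Nat.totient q := abs_of_nonneg (by positivity)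
  calc |ParityWave0.chebyshevPsiMod q a x - x / Nat.totient q + α * x ^ β / (Nat.totient q * β)|
      ≤ |ParityWave0.chebyshevPsiMod q a x - x / Nat.totient q| +
          |α * x ^ β / (Nat.totient q * β)| := abs_add_le _ _
    _ ≤ (|ParityWave0.chebyshevPsiMod q a x| + |x / Nat.totient q|) +
          2 * x / Nat.totient q := add_le_add (abs_sub _ _) h3
    _ ≤ ((x / q + 1) * Real.log x + x / Nat.totient q) + 2 * x / Nat.totient q := by
        rw [abs_of_nonneg hψ0, h2]; gcongr
    _ = (x / q + 1) * Real.log x + 3 * x / Nat.totient q := by ring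

/-! ## The three ranges -/

/-- **Small `x`** (`2 ≤ x < 64`): the quantity is at most `4400 ≤ 7·10⁶ · x e^{−c₁√log x}` for any
`c₁ ≤ 1`. [folklore] -/
theorem small_x_bound {q : ℕ} [NeZero q] (a : ZMod q) {x β α c₁ : ℝ} (hx : 2 ≤ x) (hx64 : x < 64)
    (hβ : 1 / 2 ≤ β) (hβ1 : β ≤ 1) (hα : |α| ≤ 1) (hc₁1 : c₁ ≤ 1) :
    |ParityWave0.chebyshevPsiMod q a x - x / Nat.totient q +
        α * x ^ β / (Nat.totient q * β)| ≤
      7000000 * x * Real.exp (-c₁ * Real.sqrt (Real.log x)) := by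
  have hx1 : 1 ≤ x := by linarith
  have hx0 : 0 < x := by linarith
  have hq1 : (1 : ℝ) ≤ q := by exact_mod_cast NeZero.one_le
  have hφ1 : (1 : ℝ) ≤ Nat.totient q := by exact_mod_cast Nat.totient_pos.2 (NeZero.pos q)
  have h := abs_sub_main_le_trivial a hx1 hβ hβ1 hα
  -- the trivial bound is `≤ 4400`
  have hlog : Real.log x ≤ 64 := (Real.log_le_self hx0.le).trans hx64.le
  have hlog0 : 0 ≤ Real.log x := Real.log_nonneg hx1
  have hxq : x / q ≤ 64 := by
    rw [div_le_iff₀ (by linarith)]; nlinarith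
  have hxφ : 3 * x / Nat.totient q ≤ 192 := by
    rw [div_le_iff₀ (by linarith)]; nlinarith
  have hval : (x / q + 1) * Real.log x + 3 * x / Nat.totient q ≤ 4400 := by
    have : (x / q + 1) * Real.log x ≤ 65 * 64 := by
      have h1 : 0 ≤ x / q + 1 := by positivity
      calc (x / q + 1) * Real.log x ≤ (64 + 1) * 64 := mul_le_mul (by linarith) hlog hlog0 (by norm_num)
        _ = 65 * 64 := by norm_num
    linarith
  -- and `x e^{-c₁ λ} ≥ 2 e^{-8}`
  have hlam : Real.sqrt (Real.log x) ≤ 8 := by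
    rw [Real.sqrt_le_left (by norm_num)]; linarith
  have hexp : Real.exp (-8) ≤ Real.exp (-c₁ * Real.sqrt (Real.log x)) := by
    refine Real.exp_le_exp.2 ?_
    have : c₁ * Real.sqrt (Real.log x) ≤ 1 * 8 :=
      mul_le_mul hc₁1 hlam (Real.sqrt_nonneg _) zero_le_one
    linarith
  have he8 : Real.exp 8 ≤ 3000 := by
    have h1 := Real.exp_one_lt_d9
    have h0 := (Real.exp_pos 1).le
    have : Real.exp 8 = Real.exp 1 ^ 8 := by rw [← Real.exp_nat_mul]; norm_num
    rw [this]
    calc Real.exp 1 ^ 8 ≤ (2.7182818286 : ℝ) ^ 8 := by gcongr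
      _ ≤ 3000 := by norm_num
  have hxe : 2 / 3000 ≤ x * Real.exp (-c₁ * Real.sqrt (Real.log x)) := by
    have h1 : Real.exp (-8) = 1 / Real.exp 8 := by rw [Real.exp_neg, one_div]
    have h2 : 1 / 3000 ≤ Real.exp (-8) := by
      rw [h1]; exact one_div_le_one_div_of_le (Real.exp_pos 8) he8
    calc (2 : ℝ) / 3000 = 2 * (1 / 3000) := by norm_num
      _ ≤ x * Real.exp (-8) := mul_le_mul hx h2 (by norm_num) hx0.le
      _ ≤ x * Real.exp (-c₁ * Real.sqrt (Real.log x)) := mul_le_mul_of_nonneg_left hexp hx0.le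
  have hxe0 : 0 ≤ x * Real.exp (-c₁ * Real.sqrt (Real.log x)) := by positivity
  calc |ParityWave0.chebyshevPsiMod q a x - x / Nat.totient q + α * x ^ β / (Nat.totient q * β)|
      ≤ 4400 := h.trans hval
    _ ≤ 7000000 * (2 / 3000) := by norm_num
    _ ≤ 7000000 * (x * Real.exp (-c₁ * Real.sqrt (Real.log x))) := by gcongr
    _ = 7000000 * x * Real.exp (-c₁ * Real.sqrt (Real.log x)) := by ring

/-- **Large `q`** (`log q > C₀√log x`, `x ≥ 64`, `0 < C₀ ≤ 1`): "the stated estimates are still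
valid, but are worse than trivial" — `ψ(x;q,a) ≤ (x/q + 1)log x` with `1/q < e^{−C₀√log x}`, and
`x/φ(q) ≤ C_d x/√q < C_d x e^{−(C₀/2)√log x}`; in all
`≤ (8/C₀² + 2 + 3C_d) x e^{−(C₀/2)√log x}`. [cite: MontgomeryVaughan2007, Corollary 11.17 (proof)] -/
theorem large_q_bound {q : ℕ} [NeZero q] (a : ZMod q) {x β α C₀ Cd : ℝ} (hx : 64 ≤ x)
    (hC₀ : 0 < C₀) (hC₀1 : C₀ ≤ 1) (hq : C₀ * Real.sqrt (Real.log x) < Real.log q)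
    (hβ : 1 / 2 ≤ β) (hβ1 : β ≤ 1) (hα : |α| ≤ 1) (hCd1 : 1 ≤ Cd)
    (hCd : Real.sqrt q ≤ Cd * Nat.totient q) :
    |ParityWave0.chebyshevPsiMod q a x - x / Nat.totient q +
        α * x ^ β / (Nat.totient q * β)| ≤
      (8 / C₀ ^ 2 + 2 + 3 * Cd) * x * Real.exp (-(C₀ / 2) * Real.sqrt (Real.log x)) := by
  have hx1 : 1 ≤ x := by linarith
  have hx0 : 0 < x := by linarith
  have h := abs_sub_main_le_trivial a hx1 hβ hβ1 hα
  obtain ⟨hlam2, -, -, -⟩ := ExcPsiData.diff_params hx (by linarith : x / 2 ≤ x)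
  set lam : ℝ := Real.sqrt (Real.log x) with hlam
  have hlx : Real.log x = lam ^ 2 := (Real.sq_sqrt (Real.log_nonneg hx1)).symm
  have hq0 : (0 : ℝ) < q := by exact_mod_cast NeZero.pos q
  have hφpos : (0 : ℝ) < Nat.totient q := by exact_mod_cast Nat.totient_pos.2 (NeZero.pos q)
  set u : ℝ := Real.exp (-(C₀ / 2) * lam) with hu
  have hu0 : 0 < u := Real.exp_pos _
  have huu : Real.exp (-(C₀ * lam)) = u * u := by rw [hu, ← Real.exp_add]; ring_nf
  -- `1/q < u²` and `1/√q < u`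
  have hqexp : Real.exp (C₀ * lam) < q := by
    have := Real.exp_lt_exp.2 hq
    rwa [Real.exp_log hq0] at this
  have hqinv : (q : ℝ)⁻¹ < u * u := by
    rw [← huu, Real.exp_neg]
    exact (inv_lt_inv₀ hq0 (Real.exp_pos _)).2 hqexp
  have hsqrt : (Real.sqrt q)⁻¹ < u := by
    have h1 : Real.exp (C₀ / 2 * lam) < Real.sqrt q := by
      rw [Real.lt_sqrt (Real.exp_pos _).le, ← Real.exp_nat_mul]
      convert hqexp using 2; ring
    have h2 : u = (Real.exp (C₀ / 2 * lam))⁻¹ := by rw [hu, ← Real.exp_neg]; ring_nf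
    rw [h2]
    exact (inv_lt_inv₀ (Real.sqrt_pos.2 hq0) (Real.exp_pos _)).2 h1
  -- `λ² u ≤ 8/C₀²` and `λ² ≤ 2 x u`
  have hlamu : lam ^ 2 * u ≤ 8 / C₀ ^ 2 := by
    have hp := Real.pow_div_factorial_le_exp (C₀ / 2 * lam) (by positivity) 2
    simp only [Nat.factorial, Nat.succ_eq_add_one, Nat.reduceAdd, Nat.cast_ofNat, mul_one] at hp
    -- hp : (C₀ / 2 * lam) ^ 2 / 2 ≤ exp (C₀ / 2 * lam)
    have hE : Real.exp (C₀ / 2 * lam) * u = 1 := by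
      rw [hu, ← Real.exp_add]; ring_nf; exact Real.exp_zero
    have hp' : C₀ ^ 2 * lam ^ 2 ≤ 8 * Real.exp (C₀ / 2 * lam) := by
      have : (C₀ / 2 * lam) ^ 2 / 2 = C₀ ^ 2 * lam ^ 2 / 8 := by ring
      rw [this] at hp; linarith
    have h2 := mul_le_mul_of_nonneg_right hp' hu0.le
    rw [mul_assoc (8 : ℝ), hE, mul_one] at h2
    rw [le_div_iff₀ (by positivity)]
    linarith
  have hxu : lam ^ 2 ≤ 2 * (x * u) := by
    have h1 : x * u = Real.exp (lam ^ 2 + -(C₀ / 2) * lam) := by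
      rw [Real.exp_add, ← hlx, Real.exp_log hx0]
    have h2 : lam ^ 2 / 2 ≤ lam ^ 2 + -(C₀ / 2) * lam := by
      have hCl : C₀ * lam ≤ lam * lam := mul_le_mul_of_nonneg_right (by linarith) (by linarith)
      nlinarith
    have h3 := Real.add_one_le_exp (lam ^ 2 / 2)
    have h4 := Real.exp_le_exp.2 h2
    rw [h1]
    linarith
  -- the two terms
  have hT1 : (x / q + 1) * Real.log x ≤ (8 / C₀ ^ 2 + 2) * (x * u) := by
    have hxl : 0 ≤ x * lam ^ 2 := by positivity
    have h1 : x / q * lam ^ 2 ≤ (lam ^ 2 * u) * (x * u) := by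
      calc x / q * lam ^ 2 = (q : ℝ)⁻¹ * (x * lam ^ 2) := by ring
        _ ≤ (u * u) * (x * lam ^ 2) := mul_le_mul_of_nonneg_right hqinv.le hxl
        _ = (lam ^ 2 * u) * (x * u) := by ring
    have h3 : (lam ^ 2 * u) * (x * u) ≤ (8 / C₀ ^ 2) * (x * u) :=
      mul_le_mul_of_nonneg_right hlamu (by positivity)
    calc (x / q + 1) * Real.log x = x / q * lam ^ 2 + lam ^ 2 := by rw [hlx]; ring
      _ ≤ (8 / C₀ ^ 2) * (x * u) + 2 * (x * u) := add_le_add (h1.trans h3) hxu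
      _ = (8 / C₀ ^ 2 + 2) * (x * u) := by ring
  have hT2 : 3 * x / Nat.totient q ≤ 3 * Cd * (x * u) := by
    have h1 : (Nat.totient q : ℝ)⁻¹ ≤ Cd * (Real.sqrt q)⁻¹ := by
      rw [← div_eq_mul_inv, le_div_iff₀ (Real.sqrt_pos.2 hq0)]
      calc (Nat.totient q : ℝ)⁻¹ * Real.sqrt q ≤ (Nat.totient q : ℝ)⁻¹ * (Cd * Nat.totient q) :=
            mul_le_mul_of_nonneg_left hCd (by positivity)
        _ = Cd := by field_simp
    have h2 : (Nat.totient q : ℝ)⁻¹ ≤ Cd * u :=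
      h1.trans (mul_le_mul_of_nonneg_left hsqrt.le (by linarith))
    calc 3 * x / Nat.totient q = (3 * x) * (Nat.totient q : ℝ)⁻¹ := by rw [div_eq_mul_inv]
      _ ≤ (3 * x) * (Cd * u) := mul_le_mul_of_nonneg_left h2 (by positivity)
      _ = 3 * Cd * (x * u) := by ring
  calc |ParityWave0.chebyshevPsiMod q a x - x / Nat.totient q + α * x ^ β / (Nat.totient q * β)|
      ≤ (x / q + 1) * Real.log x + 3 * x / Nat.totient q := h
    _ ≤ (8 / C₀ ^ 2 + 2) * (x * u) + 3 * Cd * (x * u) := add_le_add hT1 hT2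
    _ = (8 / C₀ ^ 2 + 2 + 3 * Cd) * x * Real.exp (-(C₀ / 2) * Real.sqrt (Real.log x)) := by
        rw [hu]; ring

/-- **Moderate `q`** (`log q ≤ (c/800)√log x`, `x ≥ 64`): Landau's method
(`Literature.NumberTheory.LFunctions.ExcPsiData.exists_psi_bound`) for `Λ_{q,a}` with the
hypotheses `PagePNT.exists_excPsiData`, divided by `φ(q)`; the constant `Kq⁵` is absorbed by
`q⁵ ≤ e^{(c/160)√log x}`. [cite: MontgomeryVaughan2007, Theorem 11.16 and Corollary 11.17] -/
theorem moderate_q_bound {c KE A : ℝ} (hKE : 0 ≤ KE) (hA : 0 < A)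
    (hpsi : ∀ {Lam : ℕ → ℝ} {F : ℂ → ℂ} {C Lv β α : ℝ}, ExcPsiData Lam F c C Lv β α →
      ∀ x : ℝ, 64 ≤ x → Lv ≤ Real.sqrt (Real.log x) →
        |ClassicalPsiData.psi Lam x - (x - α * x ^ β / β)| ≤
          A * (C + 1) * x * Real.exp (-(c / 80 * Real.sqrt (Real.log x))))
    {q : ℕ} [NeZero q] {a : ZMod q} {χ : DirichletCharacter ℂ q} {β : ℝ}
    (hdat : ExcPsiData (fun n ↦ (q.totient : ℝ) * ArithmeticFunction.vonMangoldt.residueClass a n)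
      (PagePNT.excF q a χ β) c (KE * (q : ℝ) ^ 5) (Real.log q) β (χ a).re)
    {x : ℝ} (hx : 64 ≤ x) (hq : Real.log q ≤ c / 800 * Real.sqrt (Real.log x)) :
    |ParityWave0.chebyshevPsiMod q a x - x / Nat.totient q +
        (χ a).re * x ^ β / (Nat.totient q * β)| ≤
      A * (KE + 1) * x * Real.exp (-(c / 160) * Real.sqrt (Real.log x)) := by
  have hc := hdat.c_pos
  have hc2 := hdat.c_le
  have hx0 : 0 < x := by linarith
  set lam : ℝ := Real.sqrt (Real.log x) with hlam
  have hlam0 : 0 ≤ lam := Real.sqrt_nonneg _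
  have hL : Real.log q ≤ lam := hq.trans (by nlinarith)
  have hb := hpsi hdat x hx hL
  rw [SiegelWalfisz.psi_residue_eq] at hb
  -- divide by `φ(q)`
  have hφpos : (0 : ℝ) < Nat.totient q := by exact_mod_cast Nat.totient_pos.2 (NeZero.pos q)
  have hφ1 : (1 : ℝ) ≤ Nat.totient q := by exact_mod_cast Nat.totient_pos.2 (NeZero.pos q)
  have hβ0 : β ≠ 0 := hdat.β_pos.ne'
  have hid : ParityWave0.chebyshevPsiMod q a x - x / Nat.totient q +
      (χ a).re * x ^ β / (Nat.totient q * β) =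
      ((q.totient : ℝ) * ParityWave0.chebyshevPsiMod q a x - (x - (χ a).re * x ^ β / β)) /
        Nat.totient q := by
    field_simp
    ring
  rw [hid, abs_div, abs_of_pos hφpos]
  have hB0 : 0 ≤ A * (KE * (q : ℝ) ^ 5 + 1) * x * Real.exp (-(c / 80 * lam)) := by positivity
  refine ((div_le_div_of_nonneg_right hb hφpos.le).trans (div_le_self hB0 hφ1)).trans ?_
  -- absorb `q⁵ ≤ e^{(c/160)λ}`
  have hq0 : (0 : ℝ) < q := by exact_mod_cast NeZero.pos q
  have hq5 : (q : ℝ) ^ 5 ≤ Real.exp (c / 160 * lam) := by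
    have h1 : (q : ℝ) ≤ Real.exp (c / 800 * lam) := by
      have := Real.exp_le_exp.2 hq
      rwa [Real.exp_log hq0] at this
    calc (q : ℝ) ^ 5 ≤ Real.exp (c / 800 * lam) ^ 5 := by gcongr
      _ = Real.exp (c / 160 * lam) := by rw [← Real.exp_nat_mul]; ring_nf
  have hE1 : 1 ≤ Real.exp (c / 160 * lam) := Real.one_le_exp (by positivity)
  have hprod : Real.exp (c / 160 * lam) * Real.exp (-(c / 80 * lam)) =
      Real.exp (-(c / 160) * lam) := by rw [← Real.exp_add]; ring_nf
  calc A * (KE * (q : ℝ) ^ 5 + 1) * x * Real.exp (-(c / 80 * lam))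
      ≤ A * (KE * Real.exp (c / 160 * lam) + Real.exp (c / 160 * lam)) * x *
          Real.exp (-(c / 80 * lam)) := by gcongr
    _ = A * (KE + 1) * x * (Real.exp (c / 160 * lam) * Real.exp (-(c / 80 * lam))) := by ring
    _ = A * (KE + 1) * x * Real.exp (-(c / 160) * Real.sqrt (Real.log x)) := by rw [hprod]

end PagePNT

/-! ## The discharge -/

/-- **The prime number theorem for arithmetic progressions with the exceptional-zero term**
(Page; Montgomery–Vaughan Corollary 11.17, (11.29)), PROVED:
`Literature.NumberTheory.LFunctions.PagePNTWithExceptionalZero` holds — there are absolute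
`c, c₁, K > 0` with `|ψ(x;q,a) − x/φ(q) + χ(a)x^β/(φ(q)β)| ≤ Kx e^{−c₁√log x}` for all `q ≥ 1`,
real `χ ≠ χ₀` mod `q`, real zeros `β ∈ (1 − c/log 4q, 1)` of `L(s,χ)`, `(a,q) = 1`, `x ≥ 2`.
(`c` from `PagePNT.exists_excPsiData`, `c₁ = c/1600`; the three ranges `x < 64`,
`log q ≤ (c/800)√log x`, `log q > (c/800)√log x`.)
[cite: MontgomeryVaughan2007, Corollary 11.17 (11.29)] -/
theorem PagePNTWithExceptionalZero_holds : PagePNTWithExceptionalZero := by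
  obtain ⟨c, hc, hc2, KE, hKE, hdata⟩ := PagePNT.exists_excPsiData
  obtain ⟨A, hA, hpsi⟩ := ExcPsiData.exists_psi_bound hc hc2
  obtain ⟨Cd, hCd1, hCd⟩ := PagePNT.exists_sqrt_le_mul_totient
  have hC₀ : 0 < c / 800 := by positivity
  have hC₀1 : c / 800 ≤ 1 := by linarith
  refine ⟨c, hc, c / 1600, by positivity,
    A * (KE + 1) + (8 / (c / 800) ^ 2 + 2 + 3 * Cd) + 7000000, by positivity, ?_⟩
  intro q _ χ hχ1 hquad β hβc hβ1 hβ a ha x hx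
  have hx0 : 0 < x := by linarith
  -- `β ≥ 1/2` and `|χ(a)| ≤ 1`
  have hq0 : (0 : ℝ) < q := by exact_mod_cast NeZero.pos q
  have hlog4q : 1 ≤ Real.log (4 * q) := by
    have h4 : 1 ≤ Real.log 4 := by
      have := ClassicalZFRData.one_le_log_tau 0
      rwa [abs_zero, zero_add] at this
    have hq1 : (1 : ℝ) ≤ q := by exact_mod_cast NeZero.one_le
    exact h4.trans (Real.log_le_log (by norm_num) (by nlinarith))
  have hβhalf : 1 / 2 ≤ β := by
    have : c / Real.log (4 * q) ≤ c := div_le_self hc.le hlog4q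
    linarith
  obtain ⟨-, hαle⟩ := PagePNT.quadratic_apply_inv_eq_re hquad ha
  set lam := Real.sqrt (Real.log x) with hlam
  have hKpos : 0 ≤ A * (KE + 1) ∧ 0 ≤ 8 / (c / 800) ^ 2 + 2 + 3 * Cd := ⟨by positivity, by positivity⟩
  have hxe : 0 ≤ x * Real.exp (-(c / 1600) * lam) := by positivity
  rcases lt_or_ge x 64 with hx64 | hx64
  · -- small `x`
    have h := PagePNT.small_x_bound a hx hx64 hβhalf hβ1.le hαle (c₁ := c / 1600) (by linarith)
    refine h.trans ?_
    nlinarith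
  · rcases le_or_gt (Real.log q) (c / 800 * lam) with hq | hq
    · -- moderate `q`: Landau's method
      have hdat := hdata q χ hχ1 hquad β hβc hβ1 hβ a ha
      have h := PagePNT.moderate_q_bound hKE hA hpsi hdat hx64 hq
      have hmono : Real.exp (-(c / 160) * lam) ≤ Real.exp (-(c / 1600) * lam) :=
        Real.exp_le_exp.2 (by nlinarith [Real.sqrt_nonneg (Real.log x)])
      refine h.trans ?_
      have : A * (KE + 1) * x * Real.exp (-(c / 160) * lam) ≤
          A * (KE + 1) * x * Real.exp (-(c / 1600) * lam) :=
        mul_le_mul_of_nonneg_left hmono (by positivity)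
      nlinarith
    · -- large `q`: trivial bounds
      have h := PagePNT.large_q_bound a hx64 hC₀ hC₀1 hq hβhalf hβ1.le hαle hCd1
        (hCd q (NeZero.ne q))
      have heq : Real.exp (-(c / 800 / 2) * lam) = Real.exp (-(c / 1600) * lam) := by
        congr 1; ring
      rw [heq] at h
      refine h.trans ?_
      nlinarith

end Literature.NumberTheory.LFunctions
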